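import Summits.QuantumFields.YangMills.Theorems.ColdStartUniversalityLatticeLangevinConjugationIdentity
import Summits.QuantumFields.YangMills.Theorems.ColdStartUniversalityColdStartSolutionsExistTruncated
import Summits.QuantumFields.YangMills.Theorems.ColdStartUniversalityColdStartSolutionsExistQuaternion
import HarnessLib

/-!
# Route `ColdStartUniversality` (fixed-cut-off SZZ dynamics; conjugation calculus, file 6):
# ★★ PATHWISE SYNCHRONOUS COUPLING — two SZZ solutions driven by the same noise stay exponentially close, SURELY

Helper file (seat `ym-line-csu-p1`, g23).  From the pathwise conjugation identity with `β₁ = β₂ = β`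
(`reIm_conjProduct_pair_eq_add_integral`): for a regular solution family `U` of the SU(2) lattice Langevin dynamics at
coupling `β` on `(ℤ/L)³` and two starts `x, y` (SAME flat noise), the conjugated product `V_e = (ρU^y_e)ᴴ ρU^x_e` is `C¹`
with `‖V̇_e‖_F = ‖D(U^x)_e − D(U^y)_e‖_F`, `‖V_e − 1‖_F = ‖ρU^x_e − ρU^y_e‖_F`, so Grönwall gives the SURE estimate

  `Σ_e ‖ρU^x_e(t) − ρU^y_e(t)‖_F² ≤ e^{K t} · Σ_e ‖ρx_e − ρy_e‖_F²`   almost surely, for ALL `t ≥ 0`,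

with `K = K(L, β)` (`synchronous_coupling_hsDist_le`).  The tree's `latticeLangevin_contDep` (g5) is the same estimate
IN EXPECTATION (`E sup_{s≤t}`); here it holds path by path (synchronous coupling is an a.s. `e^{Kt/2}`-Lipschitz map
`x ↦ U^x_t(ω)`), which is what coupling constructions and the stochastic-flow upgrade of `LatticeLangevinMeasurableFlow`
(Kunita) use.  Ingredients: `hsForm_mul_left_of_conjTranspose_mul_eq_one` (unitary invariance), `two_mul_hsForm_le`,
`exists_lipschitz_driftDiff` (Lipschitz bound for `(D(U) − D(U'))ρU_e` from the tame truncated system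
`exists_truncatedCoefficients` and the coefficient bound `exists_bound_coeff`).  THEOREMS ONLY, no sorry.  HONEST
FRAMING: fixed cut-off, `K` depends on `L` and `β` (no uniformity claimed); no crux, rung or summit statement is proved;
the Yang–Mills mass gap is NOT proved.
-/

set_option autoImplicit false

noncomputable section

namespace Summit.QuantumFields.YangMills.Theorems.ColdStartUniversality

open MeasureTheory ProbabilityTheory Finset Filter
open scoped NNReal Matrix ComplexConjugate Topology Matrix.Norms.Frobenius
open Literature.Probability.Process Literature.MathematicalPhysics.QuantumFieldTheory
open Literature.MathematicalPhysics.QuantumLattice (fundamentalRep fundamentalLatticeRep continuous_fundamentalRep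
  fundamentalRep_mem_unitaryGroup)

variable {L : ℕ}

/-! ## Hilbert–Schmidt algebra -/

/-- **Unitary invariance on the left**: `‖W Y‖_F = ‖Y‖_F` when `Wᴴ W = 1`. [folklore] -/
theorem hsForm_mul_left_of_conjTranspose_mul_eq_one {N : ℕ} {W : Matrix (Fin N) (Fin N) ℂ} (hW : Wᴴ * W = 1)
    (Y : Matrix (Fin N) (Fin N) ℂ) : hsForm N (W * Y) (W * Y) = hsForm N Y Y := by
  rw [hsForm_apply, hsForm_apply, Matrix.conjTranspose_mul, Matrix.mul_assoc, Matrix.trace_mul_comm,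
    Matrix.mul_assoc, Matrix.mul_assoc, hW, Matrix.mul_one]

/-- `2 |⟨X, Y⟩_{HS}| ≤ ‖X‖² + ‖Y‖²`. [folklore] -/
theorem two_mul_abs_hsForm_le {N : ℕ} (X Y : Matrix (Fin N) (Fin N) ℂ) :
    2 * |hsForm N X Y| ≤ hsForm N X X + hsForm N Y Y := by
  have h1 : 0 ≤ hsForm N (X - Y) (X - Y) := hsForm_self_nonneg _
  have h2 : 0 ≤ hsForm N (X + Y) (X + Y) := hsForm_self_nonneg _
  have e1 : hsForm N (X - Y) (X - Y) = hsForm N X X - 2 * hsForm N X Y + hsForm N Y Y := by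
    simp only [map_sub, LinearMap.sub_apply, hsForm_comm Y X]; ring
  have e2 : hsForm N (X + Y) (X + Y) = hsForm N X X + 2 * hsForm N X Y + hsForm N Y Y := by
    simp only [map_add, LinearMap.add_apply, hsForm_comm Y X]; ring
  rw [e1] at h1; rw [e2] at h2
  rcases le_or_gt 0 (hsForm N X Y) with h | h
  · rw [abs_of_nonneg h]; linarith
  · rw [abs_of_neg h]; linarith

/-! ## The Lipschitz bound for the conjugated drift difference -/

/-- **Lipschitz bound for the drift difference acting on the link**: there is `K₀ ≥ 0` (depending on `L, β`) with
`Σ_e ‖(D_β(U)_e − D_β(U')_e) ρU_e‖_F² ≤ K₀ Σ_e ‖ρU_e − ρU'_e‖_F²` for all configurations `U, U'`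
(`(D − D')Q = (b − b') − b' Q'ᴴ (Q − Q')` with the full drift `b = (D + C_𝔤)Q`, the tame Lipschitz system of
`exists_truncatedCoefficients` and the bound `exists_bound_coeff`). [folklore] -/
theorem exists_lipschitz_driftDiff (L : ℕ) [NeZero L] (β : ℝ) :
    ∃ K₀ : ℝ, 0 ≤ K₀ ∧ ∀ (U U' : GaugeConfig 3 L (Matrix.specialUnitaryGroup (Fin 2) ℂ)),
      ∑ e, hsForm (fundamentalLatticeRep 2).N
        (((fundamentalLatticeRep 2).driftLie β (matrixConfig (fundamentalLatticeRep 2).ρ U) e -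
          (fundamentalLatticeRep 2).driftLie β (matrixConfig (fundamentalLatticeRep 2).ρ U') e) *
          (fundamentalLatticeRep 2).ρ (U e))
        (((fundamentalLatticeRep 2).driftLie β (matrixConfig (fundamentalLatticeRep 2).ρ U) e -
          (fundamentalLatticeRep 2).driftLie β (matrixConfig (fundamentalLatticeRep 2).ρ U') e) *
          (fundamentalLatticeRep 2).ρ (U e)) ≤
      K₀ * ∑ e, hsForm (fundamentalLatticeRep 2).N
        ((fundamentalLatticeRep 2).ρ (U e) - (fundamentalLatticeRep 2).ρ (U' e))
        ((fundamentalLatticeRep 2).ρ (U e) - (fundamentalLatticeRep 2).ρ (U' e)) := by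
  obtain ⟨S, ⟨⟨KS, hKS⟩, -⟩, -, hAgree⟩ := exists_truncatedCoefficients L β
  obtain ⟨M, hM⟩ := exists_bound_coeff (L := L) β
  -- abbreviations
  set r2 := fundamentalLatticeRep 2 with hr2
  have hρu : ∀ g : Matrix.specialUnitaryGroup (Fin 2) ℂ, r2.ρ g ∈ Matrix.unitaryGroup (Fin r2.N) ℂ := r2.mem_unitary
  -- the drift bound in Frobenius norm: `‖b‖² ≤ card² M²`
  set CB : ℝ := (Fintype.card (Fin r2.N) : ℝ) * (Fintype.card (Fin r2.N) : ℝ) * M ^ 2 with hCB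
  have hM0 : 0 ≤ M := (norm_nonneg _).trans (hM (fun _ => 1) (Classical.arbitrary _) 0 0).1
  have hb_bd : ∀ (V : GaugeConfig 3 L (Matrix.specialUnitaryGroup (Fin 2) ℂ)) (e : Edge 3 L),
      hsForm r2.N ((latticeLangevinDynamics r2 β).drift (matrixConfig r2.ρ V) e)
        ((latticeLangevinDynamics r2 β).drift (matrixConfig r2.ρ V) e) ≤ CB := by
    intro V e
    rw [hsForm_self]
    have h1 : ∀ k l : Fin r2.N, ‖(latticeLangevinDynamics r2 β).drift (matrixConfig r2.ρ V) e k l‖ ^ 2 ≤ M ^ 2 :=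
      fun k l => pow_le_pow_left₀ (norm_nonneg _) ((hM V e k l).1) 2
    calc ∑ k, ∑ l, ‖(latticeLangevinDynamics r2 β).drift (matrixConfig r2.ρ V) e k l‖ ^ 2
        ≤ ∑ _k : Fin r2.N, ∑ _l : Fin r2.N, M ^ 2 := sum_le_sum fun k _ => sum_le_sum fun l _ => h1 k l
      _ = CB := by simp [hCB]; ring
  -- Lipschitz of the drift (from the tame system, which agrees with the SZZ drift on the group)
  have hKS0 : ∀ (V V' : GaugeConfig 3 L (Matrix.specialUnitaryGroup (Fin 2) ℂ)) (e : Edge 3 L),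
      hsForm r2.N ((latticeLangevinDynamics r2 β).drift (matrixConfig r2.ρ V) e -
          (latticeLangevinDynamics r2 β).drift (matrixConfig r2.ρ V') e)
        ((latticeLangevinDynamics r2 β).drift (matrixConfig r2.ρ V) e -
          (latticeLangevinDynamics r2 β).drift (matrixConfig r2.ρ V') e) ≤
      KS * ∑ e', hsForm r2.N (r2.ρ (V e') - r2.ρ (V' e')) (r2.ρ (V e') - r2.ρ (V' e')) := by
    intro V V' e
    have h := (hKS (matrixConfig (fundamentalRep (Fin 2)) V) (matrixConfig (fundamentalRep (Fin 2)) V') e).1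
    rw [(hAgree V e).1, (hAgree V' e).1] at h
    exact h
  set KS' : ℝ := max KS 0 with hKS'
  have hKS1 : ∀ (V V' : GaugeConfig 3 L (Matrix.specialUnitaryGroup (Fin 2) ℂ)) (e : Edge 3 L),
      hsForm r2.N ((latticeLangevinDynamics r2 β).drift (matrixConfig r2.ρ V) e -
          (latticeLangevinDynamics r2 β).drift (matrixConfig r2.ρ V') e)
        ((latticeLangevinDynamics r2 β).drift (matrixConfig r2.ρ V) e -
          (latticeLangevinDynamics r2 β).drift (matrixConfig r2.ρ V') e) ≤
      KS' * ∑ e', hsForm r2.N (r2.ρ (V e') - r2.ρ (V' e')) (r2.ρ (V e') - r2.ρ (V' e')) := fun V V' e =>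
    (hKS0 V V' e).trans (mul_le_mul_of_nonneg_right (le_max_left _ _) (sum_nonneg fun _ _ => hsForm_self_nonneg _))
  -- the constant
  refine ⟨2 * KS' * (Fintype.card (Edge 3 L) : ℝ) + 2 * CB * (r2.N : ℝ), by positivity, fun U U' => ?_⟩
  set Ssum : ℝ := ∑ e', hsForm r2.N (r2.ρ (U e') - r2.ρ (U' e')) (r2.ρ (U e') - r2.ρ (U' e')) with hS
  have hS0 : 0 ≤ Ssum := sum_nonneg fun _ _ => hsForm_self_nonneg _
  -- the per-link estimate
  have hlink : ∀ e : Edge 3 L,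
      hsForm r2.N (((r2.driftLie β (matrixConfig r2.ρ U) e - r2.driftLie β (matrixConfig r2.ρ U') e) * r2.ρ (U e)))
        (((r2.driftLie β (matrixConfig r2.ρ U) e - r2.driftLie β (matrixConfig r2.ρ U') e) * r2.ρ (U e))) ≤
      2 * KS' * Ssum + 2 * CB * (r2.N : ℝ) * hsForm r2.N (r2.ρ (U e) - r2.ρ (U' e)) (r2.ρ (U e) - r2.ρ (U' e)) := by
    intro e
    set Q := r2.ρ (U e) with hQ
    set Q' := r2.ρ (U' e) with hQ'
    set b := (latticeLangevinDynamics r2 β).drift (matrixConfig r2.ρ U) e with hb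
    set b' := (latticeLangevinDynamics r2 β).drift (matrixConfig r2.ρ U') e with hb'
    set D := r2.driftLie β (matrixConfig r2.ρ U) e with hD
    set D' := r2.driftLie β (matrixConfig r2.ρ U') e with hD'
    have hQ'u : Q' * Q'ᴴ = 1 := by
      rw [← Matrix.star_eq_conjTranspose]; exact Matrix.mem_unitaryGroup_iff.1 (hρu (U' e))
    have hbD : b = (D + r2.casimir) * Q := by
      simp only [hb, hD, hQ, latticeLangevinDynamics_drift]; rfl
    have hbD' : b' = (D' + r2.casimir) * Q' := by
      simp only [hb', hD', hQ', latticeLangevinDynamics_drift]; rfl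
    -- the algebraic identity `(D − D') Q = (b − b') − b' Q'ᴴ (Q − Q')`
    have hid : (D - D') * Q = (b - b') - b' * (Q'ᴴ * (Q - Q')) := by
      rw [hbD, hbD']
      have h1 : (D' + r2.casimir) * Q' * (Q'ᴴ * (Q - Q')) = (D' + r2.casimir) * (Q - Q') := by
        rw [← Matrix.mul_assoc, Matrix.mul_assoc (D' + r2.casimir) Q' Q'ᴴ, hQ'u, Matrix.mul_one]
      rw [h1]
      simp only [Matrix.sub_mul, Matrix.add_mul, Matrix.mul_sub]
      abel
    -- norms
    have hnorm : ‖(D - D') * Q‖ ≤ ‖b - b'‖ + ‖b'‖ * (‖Q'ᴴ‖ * ‖Q - Q'‖) := by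
      rw [hid]
      calc ‖b - b' - b' * (Q'ᴴ * (Q - Q'))‖ ≤ ‖b - b'‖ + ‖b' * (Q'ᴴ * (Q - Q'))‖ := norm_sub_le _ _
        _ ≤ ‖b - b'‖ + ‖b'‖ * (‖Q'ᴴ‖ * ‖Q - Q'‖) := by
            gcongr
            exact (norm_mul_le _ _).trans (mul_le_mul_of_nonneg_left (norm_mul_le _ _) (norm_nonneg _))
    have hQ'n : ‖Q'ᴴ‖ ^ 2 = (r2.N : ℝ) := by
      rw [← hsForm_self_eq_norm_sq]
      refine hsForm_self_of_mem_unitaryGroup ?_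
      rw [← Matrix.star_eq_conjTranspose]; exact Unitary.star_mem (hρu (U' e))
    have hbn : ‖b'‖ ^ 2 ≤ CB := by rw [← hsForm_self_eq_norm_sq]; exact hb_bd U' e
    have hbb : ‖b - b'‖ ^ 2 ≤ KS' * Ssum := by rw [← hsForm_self_eq_norm_sq]; exact hKS1 U U' e
    have hΔ : ‖Q - Q'‖ ^ 2 = hsForm r2.N (r2.ρ (U e) - r2.ρ (U' e)) (r2.ρ (U e) - r2.ρ (U' e)) := by
      rw [← hsForm_self_eq_norm_sq]
    rw [hsForm_self_eq_norm_sq, ← hΔ]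
    have hA : 0 ≤ ‖b - b'‖ := norm_nonneg _
    have hBn : 0 ≤ ‖b'‖ * (‖Q'ᴴ‖ * ‖Q - Q'‖) := by positivity
    calc ‖(D - D') * Q‖ ^ 2 ≤ (‖b - b'‖ + ‖b'‖ * (‖Q'ᴴ‖ * ‖Q - Q'‖)) ^ 2 :=
          pow_le_pow_left₀ (norm_nonneg _) hnorm 2
      _ ≤ 2 * ‖b - b'‖ ^ 2 + 2 * (‖b'‖ * (‖Q'ᴴ‖ * ‖Q - Q'‖)) ^ 2 := by
          nlinarith [sq_nonneg (‖b - b'‖ - ‖b'‖ * (‖Q'ᴴ‖ * ‖Q - Q'‖))]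
      _ = 2 * ‖b - b'‖ ^ 2 + 2 * (‖b'‖ ^ 2 * ‖Q'ᴴ‖ ^ 2 * ‖Q - Q'‖ ^ 2) := by ring
      _ ≤ 2 * (KS' * Ssum) + 2 * (CB * (r2.N : ℝ) * ‖Q - Q'‖ ^ 2) := by
          rw [hQ'n]
          gcongr
      _ = 2 * KS' * Ssum + 2 * CB * (r2.N : ℝ) * ‖Q - Q'‖ ^ 2 := by ring
  -- sum over links
  calc ∑ e, hsForm r2.N (((r2.driftLie β (matrixConfig r2.ρ U) e - r2.driftLie β (matrixConfig r2.ρ U') e) * r2.ρ (U e)))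
        (((r2.driftLie β (matrixConfig r2.ρ U) e - r2.driftLie β (matrixConfig r2.ρ U') e) * r2.ρ (U e)))
      ≤ ∑ e : Edge 3 L, (2 * KS' * Ssum +
          2 * CB * (r2.N : ℝ) * hsForm r2.N (r2.ρ (U e) - r2.ρ (U' e)) (r2.ρ (U e) - r2.ρ (U' e))) :=
        sum_le_sum fun e _ => hlink e
    _ = 2 * KS' * (Fintype.card (Edge 3 L) : ℝ) * Ssum + 2 * CB * (r2.N : ℝ) * Ssum := by
        rw [sum_add_distrib, sum_const, ← mul_sum, nsmul_eq_mul, Finset.card_univ]; ring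
    _ = (2 * KS' * (Fintype.card (Edge 3 L) : ℝ) + 2 * CB * (r2.N : ℝ)) * Ssum := by ring

/-! ## Pathwise synchronous coupling -/

/-- ★★ **Pathwise synchronous coupling.**  There is `K = K(L, β)` such that for every probability space with a flat
Brownian motion, every regular solution family `U` of the SZZ dynamics at coupling `β` and all starts `x, y`: almost
surely, for ALL `t ≥ 0`, `Σ_e ‖ρU^x_e(t) − ρU^y_e(t)‖_F² ≤ e^{Kt} Σ_e ‖ρx_e − ρy_e‖_F²` (the two solutions are driven
by the SAME noise; the estimate is sure, not in expectation). [folklore] -/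
theorem synchronous_coupling_hsDist_le (L : ℕ) [NeZero L] (β : ℝ) :
    ∃ K : ℝ, ∀ {Ω : Type} [MeasurableSpace Ω] {P : Measure Ω} [IsProbabilityMeasure P]
      {W : ℝ≥0 → Ω → (Edge 3 L × NoiseIdx 2 → ℝ)} (hW : IsFlatBrownian W P)
      (U : GaugeConfig 3 L (Matrix.specialUnitaryGroup (Fin 2) ℂ) → ℝ≥0 → Ω →
        GaugeConfig 3 L (Matrix.specialUnitaryGroup (Fin 2) ℂ))
      (_hU : ∀ x, (∀ ω, U x 0 ω = x) ∧
        (latticeLangevinDynamics (fundamentalLatticeRep 2) β).IsSolution (fundamentalRep (Fin 2)) hW.natFiltration P W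
          (U x))
      (_hUm : ∀ i : ℝ≥0, Measurable[@Prod.instMeasurableSpace (Set.Iic i)
          (GaugeConfig 3 L (Matrix.specialUnitaryGroup (Fin 2) ℂ) × Ω) inferInstance
          (@Prod.instMeasurableSpace (GaugeConfig 3 L (Matrix.specialUnitaryGroup (Fin 2) ℂ)) Ω inferInstance
            (hW.natFiltration i))]
        (fun q : Set.Iic i × (GaugeConfig 3 L (Matrix.specialUnitaryGroup (Fin 2) ℂ) × Ω) => U q.2.1 q.1 q.2.2))
      (x y : GaugeConfig 3 L (Matrix.specialUnitaryGroup (Fin 2) ℂ)),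
      ∀ᵐ ω ∂P, ∀ t : ℝ≥0,
        ∑ e, hsForm (fundamentalLatticeRep 2).N
          ((fundamentalLatticeRep 2).ρ (U x t ω e) - (fundamentalLatticeRep 2).ρ (U y t ω e))
          ((fundamentalLatticeRep 2).ρ (U x t ω e) - (fundamentalLatticeRep 2).ρ (U y t ω e)) ≤
        Real.exp (K * t) * ∑ e, hsForm (fundamentalLatticeRep 2).N
          ((fundamentalLatticeRep 2).ρ (x e) - (fundamentalLatticeRep 2).ρ (y e))
          ((fundamentalLatticeRep 2).ρ (x e) - (fundamentalLatticeRep 2).ρ (y e)) := by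
  obtain ⟨K₀, hK₀, hLip⟩ := exists_lipschitz_driftDiff L β
  refine ⟨1 + K₀, fun {Ω} _ {P} _ {W} hW U hU hUm x y => ?_⟩
  set r2 := fundamentalLatticeRep 2 with hr2
  have hρu : ∀ g : Matrix.specialUnitaryGroup (Fin 2) ℂ, r2.ρ g ∈ Matrix.unitaryGroup (Fin r2.N) ℂ := r2.mem_unitary
  -- the conjugation identity for the pair `(U y, U x)` (same family, same coupling), all links/entries/parts at once
  have hid : ∀ (e : Edge 3 L) (k l : Fin r2.N) (c : Bool), ∀ᵐ ω ∂P, ∀ t : ℝ≥0,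
      (fun z : ℂ => if c then z.im else z.re) (((r2.ρ (U y t ω e))ᴴ * r2.ρ (U x t ω e)) k l) =
      (fun z : ℂ => if c then z.im else z.re) (((r2.ρ (y e))ᴴ * r2.ρ (x e)) k l) +
      ∫ r in Set.Ioc (0 : ℝ) t, (fun z : ℂ => if c then z.im else z.re)
        (((r2.ρ (U y r.toNNReal ω e))ᴴ *
          (r2.driftLie β (matrixConfig r2.ρ (U x r.toNNReal ω)) e -
            r2.driftLie β (matrixConfig r2.ρ (U y r.toNNReal ω)) e) *
          r2.ρ (U x r.toNNReal ω e)) k l) := fun e k l c =>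
    reIm_conjProduct_pair_eq_add_integral L (fun _ => β) hW (fun _ => U) (fun _ x' => hU x') (fun _ i => hUm i)
      (fun s => cond s x y) e k l c
  have hall : ∀ᵐ ω ∂P, ∀ (e : Edge 3 L) (k l : Fin r2.N) (c : Bool) (t : ℝ≥0),
      (fun z : ℂ => if c then z.im else z.re) (((r2.ρ (U y t ω e))ᴴ * r2.ρ (U x t ω e)) k l) =
      (fun z : ℂ => if c then z.im else z.re) (((r2.ρ (y e))ᴴ * r2.ρ (x e)) k l) +
      ∫ r in Set.Ioc (0 : ℝ) t, (fun z : ℂ => if c then z.im else z.re)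
        (((r2.ρ (U y r.toNNReal ω e))ᴴ *
          (r2.driftLie β (matrixConfig r2.ρ (U x r.toNNReal ω)) e -
            r2.driftLie β (matrixConfig r2.ρ (U y r.toNNReal ω)) e) *
          r2.ρ (U x r.toNNReal ω e)) k l) :=
    ae_all_iff.2 fun e => ae_all_iff.2 fun k => ae_all_iff.2 fun l => ae_all_iff.2 fun c => hid e k l c
  filter_upwards [hall, (hU x).2.continuous, (hU y).2.continuous] with ω hω hcx hcy t
  -- continuity of the integrand matrix `A_e(r)` along the path
  have hQc : ∀ (z : GaugeConfig 3 L (Matrix.specialUnitaryGroup (Fin 2) ℂ)) (e : Edge 3 L),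
      Continuous (fun s : ℝ≥0 => U z s ω) → Continuous fun r : ℝ => r2.ρ (U z r.toNNReal ω e) := fun z e hc =>
    r2.continuous.comp ((continuous_apply e).comp (hc.comp continuous_real_toNNReal))
  have hAc : ∀ e : Edge 3 L, Continuous fun r : ℝ => (r2.ρ (U y r.toNNReal ω e))ᴴ *
      (r2.driftLie β (matrixConfig r2.ρ (U x r.toNNReal ω)) e - r2.driftLie β (matrixConfig r2.ρ (U y r.toNNReal ω)) e) *
      r2.ρ (U x r.toNNReal ω e) := by
    intro e
    have hD : Continuous fun r : ℝ => r2.driftLie β (matrixConfig r2.ρ (U x r.toNNReal ω)) e -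
        r2.driftLie β (matrixConfig r2.ρ (U y r.toNNReal ω)) e :=
      ((continuous_driftLie_matrixConfig β e).comp (hcx.comp continuous_real_toNNReal)).sub
        ((continuous_driftLie_matrixConfig β e).comp (hcy.comp continuous_real_toNNReal))
    exact ((hQc y e hcy).matrix_conjTranspose.matrix_mul hD).matrix_mul (hQc x e hcx)
  -- real coordinates: `rI c`, the integrand `a`, the initial value `v0`, the primitive `w`, the target `δ`
  set rI : Bool → ℂ → ℝ := fun c z => if c then z.im else z.re with hrI
  have hrI_cont : ∀ c, Continuous (rI c) := by
    intro c; cases c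
    · exact Complex.continuous_re
    · exact Complex.continuous_im
  have hrI_sub : ∀ c (z z' : ℂ), rI c (z - z') = rI c z - rI c z' := by intro c z z'; cases c <;> simp [hrI]
  have hsum_bool_sq : ∀ z : ℂ, ∑ c : Bool, rI c z ^ 2 = z.re * z.re + z.im * z.im := by
    intro z; rw [Fintype.sum_bool]; simp [hrI]; ring
  have hsum_bool_mul : ∀ z z' : ℂ, ∑ c : Bool, rI c z * rI c z' = z.re * z'.re + z.im * z'.im := by
    intro z z'; rw [Fintype.sum_bool]; simp [hrI]; ring
  set A : Edge 3 L → ℝ → Matrix (Fin r2.N) (Fin r2.N) ℂ := fun e r => (r2.ρ (U y r.toNNReal ω e))ᴴ *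
      (r2.driftLie β (matrixConfig r2.ρ (U x r.toNNReal ω)) e - r2.driftLie β (matrixConfig r2.ρ (U y r.toNNReal ω)) e) *
      r2.ρ (U x r.toNNReal ω e) with hA
  set a : Edge 3 L → Fin r2.N → Fin r2.N → Bool → ℝ → ℝ := fun e k l c r => rI c (A e r k l) with ha
  have ha_cont : ∀ e k l c, Continuous (a e k l c) := fun e k l c =>
    (hrI_cont c).comp ((continuous_apply l).comp ((continuous_apply k).comp (hAc e)))
  set v0 : Edge 3 L → Fin r2.N → Fin r2.N → Bool → ℝ := fun e k l c => rI c (((r2.ρ (y e))ᴴ * r2.ρ (x e)) k l)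
    with hv0
  set w : Edge 3 L → Fin r2.N → Fin r2.N → Bool → ℝ → ℝ := fun e k l c u => v0 e k l c + ∫ r in (0 : ℝ)..u, a e k l c r
    with hw
  set δ : Fin r2.N → Fin r2.N → Bool → ℝ := fun k l c => rI c ((1 : Matrix (Fin r2.N) (Fin r2.N) ℂ) k l) with hδ
  set Ψ : ℝ → ℝ := fun u => ∑ e, ∑ k, ∑ l, ∑ c, (w e k l c u - δ k l c) ^ 2 with hΨ
  set Ψ' : ℝ → ℝ := fun u => ∑ e, ∑ k, ∑ l, ∑ c, 2 * (w e k l c u - δ k l c) * a e k l c u with hΨ'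
  -- derivative of `Ψ`
  have hw_deriv : ∀ e k l c u, HasDerivAt (w e k l c) (a e k l c u) u := by
    intro e k l c u
    have h := ((ha_cont e k l c).integral_hasStrictDerivAt 0 u).hasDerivAt
    exact h.const_add _
  have hΨ_deriv : ∀ u, HasDerivAt Ψ (Ψ' u) u := by
    intro u
    simp only [hΨ, hΨ']
    refine HasDerivAt.fun_sum fun e _ => HasDerivAt.fun_sum fun k _ => HasDerivAt.fun_sum fun l _ =>
      HasDerivAt.fun_sum fun c _ => ?_
    have h := ((hw_deriv e k l c u).sub_const (δ k l c)).pow 2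
    refine h.congr_deriv ?_
    norm_num
  have hΨ_cont : Continuous Ψ := continuous_iff_continuousAt.2 fun u => (hΨ_deriv u).continuousAt
  -- at nonnegative times `w = Re/Im (V − 1)` coordinates, `Ψ = Σ_e ‖ρU^x_e − ρU^y_e‖²`, `|Ψ'| ≤ (1 + K₀) Ψ`
  have hw_eq : ∀ (e : Edge 3 L) (k l : Fin r2.N) (c : Bool) (s : ℝ≥0),
      w e k l c s = rI c (((r2.ρ (U y s ω e))ᴴ * r2.ρ (U x s ω e)) k l) := by
    intro e k l c s
    have h := hω e k l c s
    simp only [hw, hv0, ha, hA]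
    rw [intervalIntegral.integral_of_le s.coe_nonneg]
    exact h.symm
  have hV1 : ∀ (e : Edge 3 L) (s : ℝ≥0), (r2.ρ (U y s ω e))ᴴ * r2.ρ (U x s ω e) - 1 =
      (r2.ρ (U y s ω e))ᴴ * (r2.ρ (U x s ω e) - r2.ρ (U y s ω e)) := by
    intro e s
    have hu : (r2.ρ (U y s ω e))ᴴ * r2.ρ (U y s ω e) = 1 := by
      rw [← Matrix.star_eq_conjTranspose]; exact Matrix.mem_unitaryGroup_iff'.1 (hρu (U y s ω e))
    rw [Matrix.mul_sub, hu]
  have hWW : ∀ (e : Edge 3 L) (s : ℝ≥0), ((r2.ρ (U y s ω e))ᴴ)ᴴ * (r2.ρ (U y s ω e))ᴴ = 1 := by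
    intro e s
    rw [Matrix.conjTranspose_conjTranspose, ← Matrix.star_eq_conjTranspose]
    exact Matrix.mem_unitaryGroup_iff.1 (hρu (U y s ω e))
  have hΨ_eq : ∀ s : ℝ≥0, Ψ s = ∑ e, hsForm r2.N (r2.ρ (U x s ω e) - r2.ρ (U y s ω e))
      (r2.ρ (U x s ω e) - r2.ρ (U y s ω e)) := by
    intro s
    simp only [hΨ]
    refine sum_congr rfl fun e _ => ?_
    rw [← hsForm_mul_left_of_conjTranspose_mul_eq_one (hWW e s), ← hV1 e s, hsForm_eq_sum_re_im]
    refine sum_congr rfl fun k _ => sum_congr rfl fun l _ => ?_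
    have hwd : ∀ c, w e k l c s - δ k l c = rI c ((((r2.ρ (U y s ω e))ᴴ * r2.ρ (U x s ω e)) - 1) k l) := by
      intro c; rw [hw_eq, hδ, Matrix.sub_apply, hrI_sub]
    simp_rw [hwd]
    rw [hsum_bool_sq]
  have hΨ'_eq : ∀ s : ℝ≥0, Ψ' s = ∑ e, 2 * hsForm r2.N ((r2.ρ (U y s ω e))ᴴ * r2.ρ (U x s ω e) - 1) (A e s) := by
    intro s
    simp only [hΨ']
    refine sum_congr rfl fun e _ => ?_
    rw [hsForm_eq_sum_re_im, mul_sum]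
    refine sum_congr rfl fun k _ => ?_
    rw [mul_sum]
    refine sum_congr rfl fun l _ => ?_
    have hwd : ∀ c, w e k l c s - δ k l c = rI c ((((r2.ρ (U y s ω e))ᴴ * r2.ρ (U x s ω e)) - 1) k l) := by
      intro c; rw [hw_eq, hδ, Matrix.sub_apply, hrI_sub]
    have : ∑ c : Bool, 2 * (w e k l c s - δ k l c) * a e k l c s =
        2 * ∑ c : Bool, rI c ((((r2.ρ (U y s ω e))ᴴ * r2.ρ (U x s ω e)) - 1) k l) * rI c (A e s k l) := by
      rw [mul_sum]; refine sum_congr rfl fun c _ => ?_; rw [hwd]; simp only [ha]; ring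
    rw [this, hsum_bool_mul]
  have hΨ'_bd : ∀ s : ℝ≥0, |Ψ' s| ≤ (1 + K₀) * Ψ s := by
    intro s
    rw [hΨ'_eq]
    have h1 : |∑ e, 2 * hsForm r2.N ((r2.ρ (U y s ω e))ᴴ * r2.ρ (U x s ω e) - 1) (A e s)| ≤
        ∑ e, (hsForm r2.N ((r2.ρ (U y s ω e))ᴴ * r2.ρ (U x s ω e) - 1) ((r2.ρ (U y s ω e))ᴴ * r2.ρ (U x s ω e) - 1) +
          hsForm r2.N (A e s) (A e s)) := by
      refine (abs_sum_le_sum_abs _ _).trans (sum_le_sum fun e _ => ?_)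
      rw [abs_mul, abs_two]
      exact two_mul_abs_hsForm_le _ _
    have h2 : ∑ e, hsForm r2.N ((r2.ρ (U y s ω e))ᴴ * r2.ρ (U x s ω e) - 1) ((r2.ρ (U y s ω e))ᴴ * r2.ρ (U x s ω e) - 1)
        = Ψ s := by
      rw [hΨ_eq]
      refine sum_congr rfl fun e _ => ?_
      rw [hV1, hsForm_mul_left_of_conjTranspose_mul_eq_one (hWW e s)]
    have h3 : ∑ e, hsForm r2.N (A e s) (A e s) ≤ K₀ * Ψ s := by
      rw [hΨ_eq]
      have hAe : ∀ e, hsForm r2.N (A e s) (A e s) = hsForm r2.N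
          ((r2.driftLie β (matrixConfig r2.ρ (U x s ω)) e - r2.driftLie β (matrixConfig r2.ρ (U y s ω)) e) *
            r2.ρ (U x s ω e))
          ((r2.driftLie β (matrixConfig r2.ρ (U x s ω)) e - r2.driftLie β (matrixConfig r2.ρ (U y s ω)) e) *
            r2.ρ (U x s ω e)) := by
        intro e
        simp only [hA, Real.toNNReal_coe, Matrix.mul_assoc]
        exact hsForm_mul_left_of_conjTranspose_mul_eq_one (hWW e s) _
      simp_rw [hAe]
      exact hLip (U x s ω) (U y s ω)
    rw [sum_add_distrib, h2] at h1
    calc |∑ e, 2 * hsForm r2.N ((r2.ρ (U y s ω e))ᴴ * r2.ρ (U x s ω e) - 1) (A e s)|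
        ≤ Ψ s + ∑ e, hsForm r2.N (A e s) (A e s) := h1
      _ ≤ Ψ s + K₀ * Ψ s := by linarith
      _ = (1 + K₀) * Ψ s := by ring
  have hΨ_nonneg : ∀ u, 0 ≤ Ψ u := fun u =>
    sum_nonneg fun _ _ => sum_nonneg fun _ _ => sum_nonneg fun _ _ => sum_nonneg fun _ _ => sq_nonneg _
  -- Grönwall on `[0, t]`
  have hG := norm_le_gronwallBound_of_norm_deriv_right_le (f := Ψ) (f' := Ψ') (δ := Ψ 0) (K := 1 + K₀) (ε := 0)
    (a := 0) (b := t) hΨ_cont.continuousOn (fun u _ => (hΨ_deriv u).hasDerivWithinAt)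
    (by rw [Real.norm_eq_abs, abs_of_nonneg (hΨ_nonneg 0)])
    (fun u hu => by
      have h := hΨ'_bd u.toNNReal
      rw [Real.coe_toNNReal _ hu.1] at h
      rw [Real.norm_eq_abs, Real.norm_eq_abs, abs_of_nonneg (hΨ_nonneg u), add_zero]
      exact h)
    t ⟨t.coe_nonneg, le_rfl⟩
  rw [gronwallBound_ε0, sub_zero, Real.norm_eq_abs, abs_of_nonneg (hΨ_nonneg _)] at hG
  -- translate back
  have h0 : Ψ 0 = ∑ e, hsForm r2.N (r2.ρ (x e) - r2.ρ (y e)) (r2.ρ (x e) - r2.ρ (y e)) := by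
    have h := hΨ_eq 0
    simp only [NNReal.coe_zero, (hU x).1 ω, (hU y).1 ω] at h
    exact h
  have ht : Ψ t = ∑ e, hsForm r2.N (r2.ρ (U x t ω e) - r2.ρ (U y t ω e)) (r2.ρ (U x t ω e) - r2.ρ (U y t ω e)) := hΨ_eq t
  rw [← ht, ← h0, mul_comm]
  exact hG

end Summit.QuantumFields.YangMills.Theorems.ColdStartUniversality

end
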